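import Summits.ResolutionOfSingularities.ResolutionOfSingularities.Theses.UniformComplexity
import Literature.AlgebraicGeometry.Resolution.QuasiProjectiveReduction

/-!
# ResolutionOfSingularities / UniformComplexity — `EmbeddedToNonembedded`

Route `ResolutionOfSingularities/UniformComplexity`, item `stmt-ResolutionOfSingularities-14701` (formerly stmt-0573)
(`EmbeddedToNonembedded`, restated 2026-08-16 in the fixed-field form: over a field `k`, if every
integral closed subscheme of every regular separated finite-type `k`-scheme has a resolution, then
every integral separated finite-type `k`-scheme has one).

The proof is the characteristic-free, field-by-field reduction
`hasResolution_of_forall_closedImmersion_regular`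
(`Literature/AlgebraicGeometry/Resolution/QuasiProjectiveReduction.lean`: Chow's lemma gives a
proper birational `X' → X` with `X'` integral and immersed in some `𝐏ⁿ_k`, hence closed in an open
subscheme of `𝐏ⁿ_k`, which is regular, separated and of finite type over `k`; transport along
proper birational morphisms), applied to the integral (hence reduced) `X`.
-/

noncomputable section

open CategoryTheory AlgebraicGeometry TopologicalSpace

set_option linter.dupNamespace false -- mandated namespace of this single-conjunct summit

namespace Summit.ResolutionOfSingularities.ResolutionOfSingularities.Theorems

open Literature.AlgebraicGeometry Literature.AlgebraicGeometry.Resolution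

/-- **`EmbeddedToNonembedded`** (item stmt-14701, formerly stmt-0573, of route
`UniformComplexity`, fixed-field form): over a field `k`, embedded resolution of integral closed
subschemes of regular separated finite-type `k`-schemes implies resolution of all integral
separated finite-type `k`-schemes —
`hasResolution_of_forall_closedImmersion_regular` applied to the integral (in particular reduced)
`X`. [folklore] -/
theorem embeddedToNonembedded_proof : Theses.UniformComplexity.EmbeddedToNonembedded := by
  intro k _ h X f hsep hft hqc hint
  exact hasResolution_of_forall_closedImmersion_regular h X f

end Summit.ResolutionOfSingularities.ResolutionOfSingularities.Theorems

end
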